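import Literature.Geometry.Lorentzian.CoordEntropyEvolution
import Literature.Geometry.Lorentzian.CoordScalarCurvatureEvolution
import Literature.Geometry.Lorentzian.CoordEntropyFormula
import Literature.Geometry.Lorentzian.CoordConjugateHeat
import Literature.Geometry.Lorentzian.CoordCurvatureNormSq
import Literature.Geometry.Lorentzian.CoordFamilyRegularity
import HarnessLib

/-!
# The evolution of `|∇S|²` and of Hamilton's quotient `|∇S|²/S` under the Ricci flow, in coordinates

Support file (everything PROVED; no definition, no named fact) for **Hamilton 1982, §11** — the
gradient estimate for the scalar curvature along the Ricci flow (Thm. 11.1; in dimension `n ≥ 4`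
Huisken 1985, Thm. 4.1), wanted by the crux `ChangGurskyYang` of route `SmoothPoincare4/EntropyRung`
(item stmt-SmoothPoincare4-10834, line `margerin-cone-hamilton-rails`, stub `stub_gradientEstimates`:
Hamilton 1986 §5.2 "the rest of the proof goes through unchanged"). In the chart calculus of
`MetricCoord` (a smooth one-parameter family of metric components `G` on `V × S` with
`∂G/∂t = −2 Ric(G)`):

* `IsMetricOn.abs_apply_apply_le_sqrt_normSqAt_mul` — `|H(w,w)| ≤ √(|H|²_G) · G(w,w)` for a
  symmetric form `H` at a positive definite point (Cauchy–Schwarz in an orthonormal basis);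
* `IsMetricFamilyOn.hasDerivWithinAt_gradSqAt_scalAt_ricciFlow` — **Hamilton 1982, Lemma 11.3**:
  `∂ₜ|∇S|² = Δ|∇S|² − 2|Hess S|² + 4 ∂_{♯dS}|Ric|²` (from `∂ₜS = ΔS + 2|Ric|²`, the evolution of
  `|∇f|²` for a time-dependent `f`, and the Bochner formula);
* `IsMetricFamilyOn.derivWithin_gradSqAt_div_scalAt_le` — **Hamilton 1982, Lemma 11.4 and the
  display following it**: where `S > 0`,
  `∂ₜ(|∇S|²/S) ≤ Δ(|∇S|²/S) + 4 ∂_{♯dS}|Ric|²/S − 2|∇S|²|Ric|²/S²`, the dropped term being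
  `−(2/S³)|S·Hess S − dS ⊗ dS|² ≤ 0`.

## References

* R. S. Hamilton, *Three-manifolds with positive Ricci curvature*, J. Differential Geom. 17 (1982)
  255–306, §7 Cor. 7.5, §11 Lemmas 11.3–11.5, Thm. 11.1. [Hamilton1982]
* G. Huisken, *Ricci deformation of the metric on a Riemannian manifold*, J. Differential Geom. 21
  (1985) 47–62, §4, Lemma 4.2, Thm. 4.1. [Huisken1985]
* P. Topping, *Lectures on the Ricci flow*, LMS LNS 325 (2006), Prop. 2.5.4, proof of Prop. 8.2.6.
  [Topping2006]
-/

noncomputable section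

set_option maxSynthPendingDepth 3

open Set Filter ContinuousLinearMap Module
open scoped Topology ContDiff

namespace Literature.Geometry.Lorentzian

namespace MetricCoord

variable {E : Type*} [NormedAddCommGroup E] [NormedSpace ℝ E] [FiniteDimensional ℝ E]
  [CompleteSpace E]

/-! ### Cauchy–Schwarz: `|H(w,w)| ≤ √|H|² · G(w,w)` -/

namespace IsMetricOn

variable {G : E → E →L[ℝ] E →L[ℝ] ℝ} {V : Set E} {x : E}

omit [CompleteSpace E] in
/-- **`|H|²_G` in an orthonormal basis is the sum of the squares of the components** of the
symmetric form `H`: `|H|² = Σ_{km} H(e_k, e_m)²`. [folklore] -/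
theorem normSqAt_eq_sum_sq_of_orthonormal (hG : IsMetricOn G V) (hx : x ∈ V)
    {ι : Type*} [Fintype ι] [DecidableEq ι] (e : Basis ι ℝ E)
    (he : ∀ i j, G x (e i) (e j) = if i = j then 1 else 0)
    {H : E →L[ℝ] E →L[ℝ] ℝ} (hH : ∀ v w, H v w = H w v) :
    normSqAt G x H = ∑ k, ∑ m, H (e k) (e m) ^ 2 := by
  have hi := hG.isInvertible x hx
  rw [hG.normSqAt_eq_sum_of_symm e hx hH]
  refine Finset.sum_congr rfl fun k _ ↦ ?_
  simp only [ginv_of_orthonormal e he hi, ite_mul, one_mul, zero_mul, Finset.sum_ite_eq,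
    Finset.mem_univ, if_true]
  -- `♯(H e_k) = Σ_m H(e_k, e_m) e_m`
  have hsharp : sharpAt G x (H (e k)) = ∑ m, H (e k) (e m) • e m := by
    conv_lhs => rw [← sum_apply_smul_of_orthonormal e he (sharpAt G x (H (e k)))]
    refine Finset.sum_congr rfl fun m _ ↦ ?_
    rw [apply_sharpAt_apply hi]
  rw [hsharp, map_sum]
  refine Finset.sum_congr rfl fun m _ ↦ ?_
  rw [map_smul, smul_eq_mul, sq]

omit [CompleteSpace E] in
/-- **Cauchy–Schwarz for a symmetric form at a positive definite point**:
`|H(w, w)| ≤ √(|H|²_G) · G(w, w)` (in an orthonormal basis `H(w,w) = Σ H_{km} w_k w_m`,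
`|H|² = Σ H_{km}²`, `G(w,w) = Σ w_k²`). The sharp constant `1` is what completes Hamilton's square
`|S·Hess S − dS ⊗ dS|² ≥ 0`. [cite: Hamilton1982, §11, Lemma 11.4] -/
theorem abs_apply_apply_le_sqrt_normSqAt_mul (hG : IsMetricOn G V) (hx : x ∈ V)
    (hpos : ∀ v : E, v ≠ 0 → 0 < G x v v) {H : E →L[ℝ] E →L[ℝ] ℝ} (hH : ∀ v w, H v w = H w v)
    (w : E) : |H w w| ≤ Real.sqrt (normSqAt G x H) * G x w w := by
  classical
  have hs := hG.symm x hx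
  obtain ⟨e, he⟩ := exists_orthonormal_basis hs hpos
  -- components
  set c : Fin (finrank ℝ E) → ℝ := fun k ↦ G x w (e k) with hc
  have hw : ∑ k, c k • e k = w := sum_apply_smul_of_orthonormal e he w
  have hGww : G x w w = ∑ k, c k ^ 2 := by
    rw [apply_eq_sum_of_orthonormal e he hs w w]
    exact Finset.sum_congr rfl fun k _ ↦ by rw [hc, sq]
  have hright : ∀ v, H v w = ∑ m, c m * H v (e m) := fun v ↦ by
    conv_lhs => rw [← hw]
    rw [map_sum]
    exact Finset.sum_congr rfl fun m _ ↦ by rw [map_smul, smul_eq_mul]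
  have hleft : ∀ v, H w v = ∑ k, c k * H (e k) v := fun v ↦ by
    rw [hH w v, hright v]
    exact Finset.sum_congr rfl fun k _ ↦ by rw [hH v (e k)]
  have hHww : H w w = ∑ k, ∑ m, c k * c m * H (e k) (e m) := by
    rw [hleft w]
    refine Finset.sum_congr rfl fun k _ ↦ ?_
    rw [hright (e k), Finset.mul_sum]
    exact Finset.sum_congr rfl fun m _ ↦ by ring
  have hnorm : normSqAt G x H = ∑ k, ∑ m, H (e k) (e m) ^ 2 :=
    hG.normSqAt_eq_sum_sq_of_orthonormal hx e he hH
  -- Cauchy–Schwarz over the product index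
  have hCS : (∑ k, ∑ m, c k * c m * H (e k) (e m)) ^ 2 ≤
      (∑ k, ∑ m, (c k * c m) ^ 2) * ∑ k, ∑ m, H (e k) (e m) ^ 2 := by
    have h := sq_sum_mul_le (ι := Fin (finrank ℝ E) × Fin (finrank ℝ E))
      (fun p ↦ c p.1 * c p.2) (fun p ↦ H (e p.1) (e p.2))
    simpa only [Fintype.sum_prod_type] using h
  have hcc : ∑ k, ∑ m, (c k * c m) ^ 2 = (∑ k, c k ^ 2) ^ 2 := by
    rw [sq (∑ k, c k ^ 2), Finset.sum_mul_sum]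
    refine Finset.sum_congr rfl fun k _ ↦ Finset.sum_congr rfl fun m _ ↦ by ring
  rw [hHww, hnorm, hGww]
  rw [hcc] at hCS
  have h0 : 0 ≤ ∑ k, c k ^ 2 := Finset.sum_nonneg fun k _ ↦ sq_nonneg _
  have h1 : 0 ≤ ∑ k, ∑ m, H (e k) (e m) ^ 2 :=
    Finset.sum_nonneg fun k _ ↦ Finset.sum_nonneg fun m _ ↦ sq_nonneg _
  have hR : (Real.sqrt (∑ k, ∑ m, H (e k) (e m) ^ 2) * ∑ k, c k ^ 2) ^ 2 =
      (∑ k, c k ^ 2) ^ 2 * ∑ k, ∑ m, H (e k) (e m) ^ 2 := by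
    rw [mul_pow, Real.sq_sqrt h1]; ring
  have hle : (∑ k, ∑ m, c k * c m * H (e k) (e m)) ^ 2 ≤
      (Real.sqrt (∑ k, ∑ m, H (e k) (e m) ^ 2) * ∑ k, c k ^ 2) ^ 2 := by rw [hR]; exact hCS
  exact abs_le_of_sq_le_sq' hle (mul_nonneg (Real.sqrt_nonneg _) h0) |>.elim
    (fun h h' ↦ abs_le.mpr ⟨h, h'⟩)

omit [CompleteSpace E] in
/-- `0 ≤ |H|²_G` for a symmetric form at a positive definite point. [folklore] -/
theorem normSqAt_nonneg_of_symm' (hG : IsMetricOn G V) (hx : x ∈ V)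
    (hpos : ∀ v : E, v ≠ 0 → 0 < G x v v) {H : E →L[ℝ] E →L[ℝ] ℝ} (hH : ∀ v w, H v w = H w v) :
    0 ≤ normSqAt G x H := by
  classical
  obtain ⟨e, he⟩ := exists_orthonormal_basis (hG.symm x hx) hpos
  rw [hG.normSqAt_eq_sum_sq_of_orthonormal hx e he hH]
  exact Finset.sum_nonneg fun k _ ↦ Finset.sum_nonneg fun m _ ↦ sq_nonneg _

end IsMetricOn

/-! ### Evolution of `|∇S|²` and of `|∇S|²/S` under the Ricci flow -/

namespace IsMetricFamilyOn

section RicciFlow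

variable {G : ℝ → E → E →L[ℝ] E →L[ℝ] ℝ} {S : Set ℝ} {V : Set E} {x : E} {t : ℝ}
  (hG : IsMetricFamilyOn G S V)
  (hfl : ∀ s ∈ S, ∀ y ∈ V, tDeriv G S s y = (-2 : ℝ) • ricAt (G s) y)
include hG hfl

/-- **Hamilton 1982, Lemma 11.3 (evolution of `|∇S|²` under the Ricci flow), in coordinates.**
Along `∂G/∂t = −2 Ric(G)` on `V × S`, at `t ∈ S`, `x ∈ V`:
`∂ₜ |∇S|² = Δ|∇S|² − 2|Hess S|² + 4 ∂_{♯dS} |Ric|²` — from `∂ₜS = ΔS + 2|Ric|²`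
(`hasDerivWithinAt_scalAt_ricciFlow`), `∂ₜ|∇f|² = 2Ric(♯Df,♯Df) + 2Dḟ(♯Df)`
(`hasDerivWithinAt_gradSqAt_ricciFlow`) and the Bochner formula (`lapAt_gradSqAt`); Hamilton
writes it as `∂ₜ|∇S|² = Δ|∇S|² − 2|∇²S|² + 4⟨∇S, ∇|Ric|²⟩`. [cite: Hamilton1982, §11, Lemma 11.3] -/
theorem hasDerivWithinAt_gradSqAt_scalAt_ricciFlow (hx : x ∈ V) (ht : t ∈ S) :
    HasDerivWithinAt (fun s ↦ gradSqAt (G s) (scalAt (G s)) x)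
      (lapAt (G t) (gradSqAt (G t) (scalAt (G t))) x
        - 2 * normSqAt (G t) x (hessAt (G t) (scalAt (G t)) x)
        + 4 * fderiv ℝ (fun y ↦ normSqAt (G t) y (ricAt (G t) y)) x
            (sharpAt (G t) x (fderiv ℝ (scalAt (G t)) x))) S t := by
  have hGt := hG.isMetricOn t ht
  have hV := hG.isOpen ht
  have hf : ContDiffOn ℝ ∞ (fun p : E × ℝ ↦ scalAt (G p.2) p.1) (V ×ˢ S) := hG.contDiffOn_scalAt_family
  have hd := hG.hasDerivWithinAt_gradSqAt_ricciFlow hfl (f := fun s y ↦ scalAt (G s) y) hf hx ht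
  -- the time derivative of the scalar curvature, as a function near `x`
  have hev : tDerivFun (fun s y ↦ scalAt (G s) y) S t =ᶠ[𝓝 x]
      fun y ↦ lapAt (G t) (scalAt (G t)) y + 2 * normSqAt (G t) y (ricAt (G t) y) := by
    filter_upwards [hV.mem_nhds hx] with y hy
    exact (hG.hasDerivWithinAt_scalAt_ricciFlow hfl hy ht).derivWithin (hG.uniqueDiffOn t ht)
  -- regularity of the pieces
  have hScont : ContDiffOn ℝ ∞ (scalAt (G t)) V := hGt.contDiffOn_scalAt
  have hlap : DifferentiableAt ℝ (lapAt (G t) (scalAt (G t))) x :=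
    ((hGt.contDiffOn_lapAt hScont).contDiffAt (hV.mem_nhds hx)).differentiableAt (by simp)
  have hnsq : DifferentiableAt ℝ (fun y ↦ normSqAt (G t) y (ricAt (G t) y)) x :=
    ((hGt.contDiffOn_normSqAt hGt.contDiffOn_ricAt).contDiffAt (hV.mem_nhds hx)).differentiableAt
      (by simp)
  have hDdot : fderiv ℝ (tDerivFun (fun s y ↦ scalAt (G s) y) S t) x =
      fderiv ℝ (lapAt (G t) (scalAt (G t))) x
        + (2 : ℝ) • fderiv ℝ (fun y ↦ normSqAt (G t) y (ricAt (G t) y)) x := by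
    rw [hev.fderiv_eq, fderiv_fun_add hlap (hnsq.const_mul 2), fderiv_const_mul hnsq]
  -- Bochner
  have hB := hGt.lapAt_gradSqAt hx hScont
  refine hd.congr_deriv ?_
  rw [hDdot, hB]
  simp only [_root_.add_apply, _root_.smul_apply, smul_eq_mul]
  ring

/-- **Hamilton 1982, Lemma 11.4 and the display after it (the quotient `|∇S|²/S`), in
coordinates.** Along `∂G/∂t = −2 Ric(G)` on `V × S`, at `t ∈ S` and a point `x ∈ V` where `G t x`
is positive definite, if `S(G t) > 0` on `V` then
`∂ₜ (|∇S|²/S) ≤ Δ(|∇S|²/S) + 4 ∂_{♯dS}|Ric|² / S − 2 |∇S|² |Ric|² / S²`: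
the exact identity carries the extra term `−(2/S³)|S·Hess S − dS ⊗ dS|²`
(`= −2|Hess S|²/S + 4 Hess S(♯dS,♯dS)/S² − 2|∇S|⁴/S³`), which is nonpositive by
`abs_apply_apply_le_sqrt_normSqAt_mul`. The derivative is `derivWithin` over `S` (one-sided at
the end points). [cite: Hamilton1982, §11, Lemma 11.4] -/
theorem derivWithin_gradSqAt_div_scalAt_le (hx : x ∈ V) (ht : t ∈ S)
    (hpos : ∀ v : E, v ≠ 0 → 0 < G t x v v) (hS : ∀ y ∈ V, 0 < scalAt (G t) y) :
    derivWithin (fun s ↦ gradSqAt (G s) (scalAt (G s)) x / scalAt (G s) x) S t ≤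
      lapAt (G t) (fun y ↦ gradSqAt (G t) (scalAt (G t)) y / scalAt (G t) y) x
        + 4 * fderiv ℝ (fun y ↦ normSqAt (G t) y (ricAt (G t) y)) x
            (sharpAt (G t) x (fderiv ℝ (scalAt (G t)) x)) / scalAt (G t) x
        - 2 * gradSqAt (G t) (scalAt (G t)) x * normSqAt (G t) x (ricAt (G t) x)
            / scalAt (G t) x ^ 2 := by
  have hGt := hG.isMetricOn t ht
  have hV := hG.isOpen ht
  have hi := hGt.isInvertible x hx
  have hsym := hGt.symm x hx
  -- notation
  set Sf : E → ℝ := scalAt (G t) with hSf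
  set Vf : E → ℝ := gradSqAt (G t) Sf with hVf
  set φ : E →L[ℝ] ℝ := fderiv ℝ Sf x with hφ
  set w : E := sharpAt (G t) x φ with hw
  set H : E →L[ℝ] E →L[ℝ] ℝ := hessAt (G t) Sf x with hH
  set A : ℝ := fderiv ℝ (fun y ↦ normSqAt (G t) y (ricAt (G t) y)) x w with hA
  set Rn : ℝ := normSqAt (G t) x (ricAt (G t) x) with hRn
  have hSx : 0 < Sf x := hS x hx
  have hSne : Sf x ≠ 0 := hSx.ne'
  -- regularity
  have hScont : ContDiffOn ℝ ∞ Sf V := hGt.contDiffOn_scalAt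
  have hVcont : ContDiffOn ℝ ∞ Vf V := hGt.contDiffOn_gradSqAt hScont
  have hucont : ContDiffOn ℝ ∞ (fun y ↦ Vf y / Sf y) V :=
    hVcont.div hScont fun y hy ↦ (hS y hy).ne'
  have hS2 : ContDiffAt ℝ 2 Sf x := ((hScont.contDiffAt (hV.mem_nhds hx)).of_le (by norm_cast))
  have hu2 : ContDiffAt ℝ 2 (fun y ↦ Vf y / Sf y) x :=
    ((hucont.contDiffAt (hV.mem_nhds hx)).of_le (by norm_cast))
  have hVd : DifferentiableAt ℝ Vf x := hGt.differentiableAt_gradSqAt hx hScont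
  have hSd : DifferentiableAt ℝ Sf x := hS2.differentiableAt (by simp)
  -- (1) time derivatives
  have hVt := hG.hasDerivWithinAt_gradSqAt_scalAt_ricciFlow hfl hx ht
  have hSt := hG.hasDerivWithinAt_scalAt_ricciFlow hfl hx ht
  have hut := hVt.div hSt hSne
  have hgoal : derivWithin (fun s ↦ gradSqAt (G s) (scalAt (G s)) x / scalAt (G s) x) S t =
      ((lapAt (G t) Vf x - 2 * normSqAt (G t) x H + 4 * A) * Sf x
          - Vf x * (lapAt (G t) Sf x + 2 * Rn)) / Sf x ^ 2 := by
    have h := hut.derivWithin (hG.uniqueDiffOn t ht)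
    rw [show ((fun s ↦ gradSqAt (G s) (scalAt (G s)) x) / fun s ↦ scalAt (G s) x) =
        fun s ↦ gradSqAt (G s) (scalAt (G s)) x / scalAt (G s) x from rfl] at h
    exact h
  rw [hgoal]
  -- (2) the Laplacian of the quotient from the product rule `Δ(u·S)`
  have hprod : lapAt (G t) (fun y ↦ (Vf y / Sf y) * Sf y) x =
      (Vf x / Sf x) * lapAt (G t) Sf x + Sf x * lapAt (G t) (fun y ↦ Vf y / Sf y) x
        + 2 * fderiv ℝ (fun y ↦ Vf y / Sf y) x w :=
    lapAt_mul (G t) hi hsym hu2 hS2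
  have hcongr : lapAt (G t) (fun y ↦ (Vf y / Sf y) * Sf y) x = lapAt (G t) Vf x := by
    refine lapAt_congr_of_eventuallyEq (G t) ?_
    filter_upwards [hV.mem_nhds hx] with y hy
    exact div_mul_cancel₀ (Vf y) (hS y hy).ne'
  -- the differential of the quotient along `♯dS`
  have hdu : fderiv ℝ (fun y ↦ Vf y / Sf y) x w =
      (2 * H w w) / Sf x - Vf x * Vf x / Sf x ^ 2 := by
    have hinv : HasFDerivAt (fun y ↦ (Sf y)⁻¹)
        ((ContinuousLinearMap.toSpanSingleton ℝ (-(Sf x ^ 2)⁻¹)).comp (fderiv ℝ Sf x)) x :=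
      (hasFDerivAt_inv hSne).comp x hSd.hasFDerivAt
    have h := (hVd.hasFDerivAt.mul hinv).fderiv
    have heq : (fun y ↦ Vf y / Sf y) = fun y ↦ Vf y * (Sf y)⁻¹ := by
      funext y; rw [div_eq_mul_inv]
    rw [heq, show (fun y ↦ Vf y * (Sf y)⁻¹) = (Vf * fun y ↦ (Sf y)⁻¹) from rfl, h]
    simp only [_root_.add_apply, _root_.smul_apply, smul_eq_mul, ContinuousLinearMap.comp_apply,
      ContinuousLinearMap.toSpanSingleton_apply]
    have hDV : fderiv ℝ Vf x w = 2 * H w w := by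
      rw [hVf, hGt.fderiv_gradSqAt hx hScont w]
    have hDS : fderiv ℝ Sf x w = Vf x := by
      rw [hw, hφ, hVf, gradSqAt_apply]
    rw [hDV, hDS]
    field_simp
    ring
  -- |∇S|² = dS(♯dS) = G(w,w)
  have hGww : G t x w w = Vf x := by
    rw [hw, apply_sharpAt_apply hi, hφ, hVf, gradSqAt_apply]
  -- (3) Hamilton's square: `2 S H(w,w) ≤ S² |H|² + |∇S|⁴`
  have hHsym : ∀ v v', H v v' = H v' v := fun v v' ↦
    hGt.hessAt_comm hx (hScont.contDiffAt (hV.mem_nhds hx)) v v'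
  have hHn : 0 ≤ normSqAt (G t) x H := hGt.normSqAt_nonneg_of_symm' hx hpos hHsym
  have hCS : |H w w| ≤ Real.sqrt (normSqAt (G t) x H) * G t x w w :=
    hGt.abs_apply_apply_le_sqrt_normSqAt_mul hx hpos hHsym w
  rw [hGww] at hCS
  have hsq : 2 * Sf x * H w w ≤ Sf x ^ 2 * normSqAt (G t) x H + Vf x ^ 2 := by
    have h1 : H w w ≤ Real.sqrt (normSqAt (G t) x H) * Vf x := (le_abs_self _).trans hCS
    have h2 : 2 * Sf x * H w w ≤ 2 * Sf x * (Real.sqrt (normSqAt (G t) x H) * Vf x) :=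
      mul_le_mul_of_nonneg_left h1 (by positivity)
    have h3 : 2 * Sf x * (Real.sqrt (normSqAt (G t) x H) * Vf x) ≤
        Sf x ^ 2 * normSqAt (G t) x H + Vf x ^ 2 := by
      nlinarith [sq_nonneg (Sf x * Real.sqrt (normSqAt (G t) x H) - Vf x), Real.sq_sqrt hHn]
    exact h2.trans h3
  -- (4) assemble
  rw [hcongr] at hprod
  -- solve `hprod` for `Δ(V/S)`
  have hlapu : lapAt (G t) (fun y ↦ Vf y / Sf y) x =
      (lapAt (G t) Vf x - (Vf x / Sf x) * lapAt (G t) Sf x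
        - 2 * ((2 * H w w) / Sf x - Vf x * Vf x / Sf x ^ 2)) / Sf x := by
    rw [← hdu, eq_div_iff hSne]
    linarith [hprod]
  rw [hlapu, ← sub_nonneg]
  have key : (lapAt (G t) Vf x - (Vf x / Sf x) * lapAt (G t) Sf x
        - 2 * ((2 * H w w) / Sf x - Vf x * Vf x / Sf x ^ 2)) / Sf x
        + 4 * A / Sf x - 2 * Vf x * Rn / Sf x ^ 2
      - ((lapAt (G t) Vf x - 2 * normSqAt (G t) x H + 4 * A) * Sf x
          - Vf x * (lapAt (G t) Sf x + 2 * Rn)) / Sf x ^ 2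
      = (2 / Sf x ^ 3) * (Sf x ^ 2 * normSqAt (G t) x H + Vf x ^ 2 - 2 * Sf x * H w w) := by
    field_simp
    ring
  have hnn : 0 ≤ (2 / Sf x ^ 3) * (Sf x ^ 2 * normSqAt (G t) x H + Vf x ^ 2 - 2 * Sf x * H w w) :=
    mul_nonneg (by positivity) (by linarith [hsq])
  rw [key]
  exact hnn

end RicciFlow

end IsMetricFamilyOn

end MetricCoord

end Literature.Geometry.Lorentzian

end
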